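import Summits.BirchSwinnertonDyer.Rank1Residual.Additive.X4SharpThreeResidue
import Summits.BirchSwinnertonDyer.Rank1Residual.GaloisImage.ExoticThreeAdicImage
import HarnessLib

/-!
# X4♯(3): the EXOTIC residue restated in the literature's hypothesis language — X4♯(3) is EQUIVALENT
# to its restriction to the surj(3) rows on which hypothesis (im) FAILS (cell `b2b-bsdres`, team n1011,
# sub-target T-a5; sequel of `Additive/X4SharpThreeResidue.lean` and `GaloisImage/ExoticThreeAdicImage.lean`)

HONEST FRAMING (cell `b2b-bsdres`, run/shared/lean/b2b/bsd-rank1-residual/, verbatim in every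
file): the goal of the cell is to DELETE the COMBINATION-SHAPED residual classes of the
Birch–Swinnerton-Dyer formula for ALL analytic-rank `≤ 1` elliptic curves over `ℚ` — "full BSD
formula for every rank `≤ 1` curve in class `C`" assembled STRICTLY from published theorems — so
that the rank-`≤ 1` remainder becomes exactly the CONSTRUCTION-SHAPED classes, which are TYPED
(missing-input `Prop`s), NOT attempted. This is not "finishing BSD". Team n1011: prove what is
provable now; shrink each hard class to its core with data; no claim beyond stated classes. Theorems
only (no definition, no named fact); the label of X4 is UNCHANGED; nothing is booked.

## What and why

`Additive.x4SharpThree_iff_residue_sharp` (additive-p4, line V21) says: granted the named facts of the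
two printed rank-`0` routes at an additive `3` (sharp Kato reading, Delbourgo Prop. 4, Wuthrich
Lemma 20, the `ω`-component divisibility, modular parametrisation data, GZK, modularity), the
conjecture `Additive.X4SharpThree` ("Kim 2026 Thm. 1.8 (6) at `p = 3`") is EQUIVALENT to its
restriction to the potentially good surj(3) rows WITHOUT `3`-adic tower surjectivity — the EXOTIC
rows, stated through the census bit `¬ ∀ n, ρ̄_{E,3^n} onto`. By `GaloisImage.not_towerSurj_three_iff_not_bigIm_of_surj`
(T-a5: under surj(3), tower surjectivity ⟺ Kato's (12.5.2) ⟺ hypothesis (im)) the same residue is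
exactly the set of surj(3) rows on which **hypothesis (im)** — Kato 2004 Thm. 13.4 (3) / BCS 2025 (im)
/ Skinner 2016 §2.5 (b) / Kim–Nakamura 2020 Assumption 4.1, the cell predicate `BigIm W 3` — FAILS:

* `x4SharpThree_iff_residue_not_bigIm` — X4♯(3) ⟺ X4♯(3) on {X4, `r_an = 0`, surj(3), `0 ≤ ord₃ j`,
  **¬(im)**};
* `exotic_upperClause_iff_not_bigIm_upperClause` — the EXOTIC clause of
  `x4SharpUnitFree_iff_lower_and_residues_sharp` (the `MissingUpperBoundAt W 3` form) is EQUIVALENT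
  to the same clause with `¬ BigIm W 3` in place of `¬ ∀ n, ρ̄_{E,3^n} onto`.

So the class-level N11 residue outside the LOWER half reads, in the words of the printed theorems:
"the analytic-rank-`0` X4 pairs at `3` with surjective mod-`3` image that violate (im)" — the exact
failing hypothesis of every Euler/Kolyvagin-system integrality clause in print or announced (the
corner theorem T-b2c may cite either form). Per pair these rows close by `3`-Selmer certificates
(`X4RankZero.bsdp_three_of_card_selmerThree_eq_one`). Nothing asserted about the residue; X4 stays
CONSTRUCTION-SHAPED; nothing booked.

References: Kato 2004 [Kato2004Asterisque] Thm. 12.5 (4) (12.5.2), Thm. 13.4 (3), Thm. 14.5 (3);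
Burungale–Castella–Skinner 2025 [BurungaleCastellaSkinner2025] (im); Kim–Nakamura 2020 [KimNakamura2020]
Assumption 4.1; Delbourgo 1998 [Delbourgo1998] Prop. 4; Wuthrich 2014 [Wuthrich2014] Lemma 20;
Miller 2011 [Miller2011LMS] Def. 1.1; N. Elkies, arXiv:math/0612734.
-/

noncomputable section

open scoped Classical

open WeierstrassCurve Literature.NumberTheory.EllipticCurves
  Literature.NumberTheory.EllipticCurves.ModularForms
  Literature.NumberTheory.EllipticCurves.Rank1Residual
  Literature.NumberTheory.EllipticCurves.Rank1Residual.Typed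
  Summit.BirchSwinnertonDyer.Rank1Residual.GaloisImage

namespace Summit.BirchSwinnertonDyer.Rank1Residual.Additive

/-- **X4♯(3) ⟺ X4♯(3) on the surj(3) rows violating (im)** (granted the sharpened Kato reading,
Delbourgo Prop. 4, Wuthrich Lemma 20, the `ω`-component divisibility, modular parametrisation data,
GZK and modularity): the EXOTIC residue of `x4SharpThree_iff_residue_sharp`, with the census bit
`¬ ∀ n, ρ̄_{E,3^n} onto` replaced by the failure of hypothesis (im) = `BigIm W 3` (Kato Thm. 13.4 (3) /
BCS (im) / Skinner §2.5 (b)), equivalent under surj(3) by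
`GaloisImage.not_towerSurj_three_iff_not_bigIm_of_surj`. Nothing asserted about the residue.
[cite: Kato2004Asterisque, Thm. 13.4 (3) (p. 226); Thm. 14.5 (3) (p. 236)] [cite: Delbourgo1998, Prop. 4 (p. 144)]
[cite: BurungaleCastellaSkinner2025, hypothesis (im)] -/
theorem x4SharpThree_iff_residue_not_bigIm
    (hKatoS : Kato2004.rankZero_padicValNat_sha_le_sub_localTamagawa_of_additive_potGood_of_imageContainsSL2)
    (hDel : Delbourgo1998.prop4_rankZero_pow_dvd_constantCoeff)
    (hGZK : rank_eq_analyticRank_of_analyticRank_le_one) (hmod : hasEntireLFunction_rat)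
    (hmodD : nonempty_modularParametrizationData)
    (hL20 : Wuthrich2014.lemma20_surjective_threeAdic_of_semistable)
    (hKatoω : Wuthrich2014.kato_minusEigenCharIdeal_dvd_cyclotomicThree_of_surjective) :
    X4SharpThree ↔
      ∀ (W : WeierstrassCurve ℚ) [W.IsElliptic] [W.IsGloballyMinimal],
        W.analyticRank = 0 → ClassX4 W 3 → Surj W 3 → 0 ≤ padicValRat 3 W.j → ¬ BigIm W 3 →
        ∀ {N : ℕ} [NeZero N] (D : ModularParametrizationData W N), ¬ (3 : ℤ) ∣ D.maninConstant →
        ∃ q : ℚ, shaAn W = (q : ℂ) ∧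
          (padicValNat 3 W.shaOrder : ℤ) ≤ padicValRat 3 q + padicValNat 3 W.tamagawaProduct := by
  haveI : Fact (Nat.Prime 3) := ⟨Nat.prime_three⟩
  rw [x4SharpThree_iff_residue_sharp hKatoS hDel hGZK hmod hmodD hL20 hKatoω]
  constructor
  · intro h V _ _ hr hX hs hj hnim N _ D hc
    exact h V hr hX hs hj ((not_towerSurj_three_iff_not_bigIm_of_surj V hs).mpr hnim) D hc
  · intro h V _ _ hr hX hs hj hnt N _ D hc
    exact h V hr hX hs hj ((not_towerSurj_three_iff_not_bigIm_of_surj V hs).mp hnt) D hc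

/-- **The EXOTIC upper-half clause ⟺ the ¬(im) upper-half clause.** The second conjunct of
`x4SharpUnitFree_iff_lower_and_residues_sharp` ("on X4 ∧ `r_an = 0` ∧ surj(3) ∧ pot-good rows WITHOUT
the `3`-adic tower, `MissingUpperBoundAt W 3`") is equivalent to the same clause on the rows violating
hypothesis (im) (`¬ BigIm W 3`). No named fact is used: pure Galois-image bookkeeping
(`GaloisImage.not_towerSurj_three_iff_not_bigIm_of_surj`). [cite: Kato2004Asterisque, Thm. 13.4 (3) (p. 226)]
[cite: BurungaleCastellaSkinner2025, hypothesis (im)] -/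
theorem exotic_upperClause_iff_not_bigIm_upperClause :
    (∀ (W : WeierstrassCurve ℚ) [W.IsElliptic] [W.IsGloballyMinimal],
        W.analyticRank = 0 → ClassX4 W 3 → Surj W 3 → 0 ≤ padicValRat 3 W.j →
        ¬ (∀ n : ℕ, W.HasSurjectiveModNGaloisRep (3 ^ n : ℕ)) → MissingUpperBoundAt W 3) ↔
    (∀ (W : WeierstrassCurve ℚ) [W.IsElliptic] [W.IsGloballyMinimal],
        W.analyticRank = 0 → ClassX4 W 3 → Surj W 3 → 0 ≤ padicValRat 3 W.j →
        ¬ BigIm W 3 → MissingUpperBoundAt W 3) := by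
  haveI : Fact (Nat.Prime 3) := ⟨Nat.prime_three⟩
  constructor
  · intro h V _ _ hr hX hs hj hnim
    exact h V hr hX hs hj ((not_towerSurj_three_iff_not_bigIm_of_surj V hs).mpr hnim)
  · intro h V _ _ hr hX hs hj hnt
    exact h V hr hX hs hj ((not_towerSurj_three_iff_not_bigIm_of_surj V hs).mp hnt)

/-- **On an EXOTIC row every printed integrality hypothesis fails at once**: for `E = W/ℚ` of class
X4 at `3` with `ρ̄_{E,3}` onto and no `3`-adic tower, Kato's (12.5.2) (`Kato2004.ImageContainsSL2 W 3`)
AND hypothesis (im) (`BigIm W 3`) both fail — so neither the V20X chain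
(`X4RankZero.bsdp_three_of_kato_of_surj_of_ram`, sharp variant) nor any (im)-based clause can be
instantiated there; what remains per pair is the `3`-Selmer certificate
(`X4RankZero.bsdp_three_exotic_of_card_selmerThree_eq_one`). The class binder is documentation only.
[cite: Kato2004Asterisque, (12.5.2) in Thm. 12.5 (4) (p. 222); Thm. 13.4 (3) (p. 226)] -/
theorem exotic_not_imageContainsSL2_and_not_bigIm {W : WeierstrassCurve ℚ} [W.IsElliptic]
    (_hX : ClassX4 W 3) (hs : Surj W 3) (hnt : ¬ ∀ n : ℕ, W.HasSurjectiveModNGaloisRep (3 ^ n : ℕ)) :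
    ¬ Kato2004.ImageContainsSL2 W 3 ∧ ¬ BigIm W 3 :=
  ⟨not_imageContainsSL2_three_of_not_towerSurj W hnt, not_bigIm_of_surj_three_of_not_towerSurj W hs hnt⟩

end Summit.BirchSwinnertonDyer.Rank1Residual.Additive

end
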